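import Summits.AtomisticToContinuum.HydrodynamicLimit.Theorems.PreShockDoorEosSeries
import Summits.AtomisticToContinuum.HydrodynamicLimit.Theorems.PolynomialCompression.Negative.Statics
import Literature.MathematicalPhysics.KineticTheory.HardSphereEulerLLN
import HarnessLib

/-!
# PreShockDoor [S] kit · Part B — `B`-uniform smallness of the reduced density, and the statics
of the limit profile through the equation of state `G = gSer (clusterCoeff σ)`

* `sigma0 B = min (1/2) (800 e² v₁ B⁶)⁻¹` and the master inequality `800 e² v₁ σ³ B⁶ < 1`;
* `SmallDensity P σ` for every profile with `sup β ≤ B²` and `0 < σ < sigma0 B` (explicit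
  monotonicity in `M = sup β`, replacing the per-profile `exists_smallDensity`);
* the profile of an activity `a ∈ [B⁻¹, B]` has `β ∈ [B⁻², B²]`;
* `rhoLim P σ x = G (R β x)`, `∫ rhoLim = 1` (`R F(R) = 1`), and with `μ = log (R / ∫ a)`:
  `exp μ · a = R β ∈ [0, 2B²]`, `G (exp μ · a) ≤ 4 B²`;
* the constants of Part G specialised to `c = clusterCoeff σ`, `A = e`, `q = e v₁ σ³`, `r = 20 B²`.
decomp-a2c lens-1 g41; 0 sorry.
-/

noncomputable section

namespace Summit.AtomisticToContinuum.HydrodynamicLimit.Theorems.PreShockDoor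

open Set Filter Topology MeasureTheory
open scoped ENNReal ContDiff
open Literature.MathematicalPhysics.KineticTheory

/-! ## The `B`-uniform smallness threshold -/

/-- The `B`-uniform threshold `σ₀(B) = min (1/2) (800 e² v₁ B⁶)⁻¹`. -/
def sigma0 (B : ℝ) : ℝ := min (1 / 2) (1 / (800 * Real.exp 1 ^ 2 * v₁ * B ^ 6))

/-- `0 < sigma0 B`. [folklore] -/
theorem sigma0_pos {B : ℝ} (hB : 1 ≤ B) : 0 < sigma0 B := by
  have hv := v₁_pos
  have he := Real.exp_pos 1
  have hB0 : 0 < B := by linarith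
  exact lt_min (by norm_num) (by positivity)

/-- `1 ≤ exp 1`. [folklore] -/
theorem one_le_exp_one : (1 : ℝ) ≤ Real.exp 1 := by
  have := Real.add_one_le_exp (1 : ℝ); linarith

/-- **Master inequality**: for `0 < σ < σ₀(B)`: `σ < 1/2` and `800 e² v₁ σ³ B⁶ < 1`. -/
theorem master_small {B σ : ℝ} (hB : 1 ≤ B) (hσ : 0 < σ) (hσ₀ : σ < sigma0 B) :
    σ < 1 / 2 ∧ 800 * (Real.exp 1 ^ 2 * v₁ * σ ^ 3 * B ^ 6) < 1 := by
  have hv := v₁_pos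
  have he := Real.exp_pos 1
  have hB0 : 0 < B := by linarith
  have h1 : σ < 1 / 2 := lt_of_lt_of_le hσ₀ (min_le_left _ _)
  have h2 : σ < 1 / (800 * Real.exp 1 ^ 2 * v₁ * B ^ 6) := lt_of_lt_of_le hσ₀ (min_le_right _ _)
  have hD : 0 < 800 * Real.exp 1 ^ 2 * v₁ * B ^ 6 := by positivity
  have hσ3 : σ ^ 3 ≤ σ := by
    have : σ ^ 2 ≤ 1 := by nlinarith
    calc σ ^ 3 = σ ^ 2 * σ := by ring
      _ ≤ 1 * σ := by gcongr
      _ = σ := one_mul σ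
  refine ⟨h1, ?_⟩
  rw [lt_div_iff₀ hD] at h2
  calc 800 * (Real.exp 1 ^ 2 * v₁ * σ ^ 3 * B ^ 6)
      ≤ 800 * (Real.exp 1 ^ 2 * v₁ * σ * B ^ 6) := by gcongr
    _ = σ * (800 * Real.exp 1 ^ 2 * v₁ * B ^ 6) := by ring
    _ < 1 := h2

/-- **The constants of Part G** for `c = clusterCoeff σ`, `A = e`, `q = e v₁ σ³`, `r = 20 B²`:
`q r ≤ 1/4`, `8 A q r ≤ 1`, `2 A q r² ≤ 1`, and `σ < 1/2`. -/
theorem constants_small {B σ : ℝ} (hB : 1 ≤ B) (hσ : 0 < σ) (hσ₀ : σ < sigma0 B) :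
    σ < 1 / 2 ∧
    Real.exp 1 * (v₁ * σ ^ 3) * (20 * B ^ 2) ≤ 1 / 4 ∧
    8 * Real.exp 1 * (Real.exp 1 * (v₁ * σ ^ 3)) * (20 * B ^ 2) ≤ 1 ∧
    2 * Real.exp 1 * (Real.exp 1 * (v₁ * σ ^ 3)) * (20 * B ^ 2) ^ 2 ≤ 1 := by
  obtain ⟨h1, hY⟩ := master_small hB hσ hσ₀
  set Y := Real.exp 1 ^ 2 * v₁ * σ ^ 3 * B ^ 6 with hYdef
  have hv := v₁_pos
  have he := Real.exp_pos 1
  have he1 := one_le_exp_one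
  have hB0 : 0 < B := by linarith
  have hB4 : (1 : ℝ) ≤ B ^ 4 := one_le_pow₀ hB
  have heB : (1 : ℝ) ≤ Real.exp 1 * B ^ 4 := one_le_mul_of_one_le_of_one_le he1 hB4
  -- the basic block `e v₁ σ³ B² ≤ Y`
  have hblock : Real.exp 1 * v₁ * σ ^ 3 * B ^ 2 ≤ Y := by
    calc Real.exp 1 * v₁ * σ ^ 3 * B ^ 2 = (Real.exp 1 * v₁ * σ ^ 3 * B ^ 2) * 1 := (mul_one _).symm
      _ ≤ (Real.exp 1 * v₁ * σ ^ 3 * B ^ 2) * (Real.exp 1 * B ^ 4) := by gcongr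
      _ = Y := by rw [hYdef]; ring
  have hB46 : B ^ 4 ≤ B ^ 6 := pow_le_pow_right₀ hB (by norm_num)
  refine ⟨h1, ?_, ?_, ?_⟩
  · calc Real.exp 1 * (v₁ * σ ^ 3) * (20 * B ^ 2) = 20 * (Real.exp 1 * v₁ * σ ^ 3 * B ^ 2) := by ring
      _ ≤ 20 * Y := by gcongr
      _ ≤ 1 / 4 := by linarith
  · calc 8 * Real.exp 1 * (Real.exp 1 * (v₁ * σ ^ 3)) * (20 * B ^ 2)
        = 160 * (Real.exp 1 ^ 2 * v₁ * σ ^ 3 * B ^ 2) := by ring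
      _ ≤ 160 * (Real.exp 1 ^ 2 * v₁ * σ ^ 3 * B ^ 2 * B ^ 4) :=
          mul_le_mul_of_nonneg_left (le_mul_of_one_le_right (by positivity) hB4) (by norm_num)
      _ = 160 * Y := by rw [hYdef]; ring
      _ ≤ 1 := by linarith
  · calc 2 * Real.exp 1 * (Real.exp 1 * (v₁ * σ ^ 3)) * (20 * B ^ 2) ^ 2
        = 800 * (Real.exp 1 ^ 2 * v₁ * σ ^ 3 * B ^ 4) := by ring
      _ ≤ 800 * (Real.exp 1 ^ 2 * v₁ * σ ^ 3 * B ^ 6) := by gcongr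
      _ ≤ 1 := hY.le


/-! ## `B`-uniform smallness of the reduced density -/

/-- **Uniform smallness.** Every profile with `sup β ≤ B²` satisfies `SmallDensity P σ` for
`0 < σ < σ₀(B)` (all the smallness quantities are monotone in `M = sup β`). -/
theorem smallDensity_of_M_le {B σ : ℝ} (hB : 1 ≤ B) (hσ : 0 < σ) (hσ₀ : σ < sigma0 B)
    (P : DensityProfile) (hM : P.M ≤ B ^ 2) : SmallDensity P σ := by
  obtain ⟨h1, hY⟩ := master_small hB hσ hσ₀
  set Y := Real.exp 1 ^ 2 * v₁ * σ ^ 3 * B ^ 6 with hYdef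
  have hv := v₁_pos
  have he := Real.exp_pos 1
  have he1 := one_le_exp_one
  have hMB6 : P.M ≤ B ^ 6 := hM.trans (pow_le_pow_right₀ hB (by norm_num))
  have hθdef : geomRatio P σ = 2 * Real.exp 1 * (P.M * v₁ * σ ^ 3) := by rw [geomRatio, ovDensity]
  have hθ0 : 0 ≤ geomRatio P σ := geomRatio_nonneg hσ.le
  -- `e θ ≤ 2 Y`
  have heθ : Real.exp 1 * geomRatio P σ ≤ 2 * Y := by
    rw [hθdef]
    calc Real.exp 1 * (2 * Real.exp 1 * (P.M * v₁ * σ ^ 3)) = 2 * (Real.exp 1 ^ 2 * v₁ * σ ^ 3) * P.M := by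
          ring
      _ ≤ 2 * (Real.exp 1 ^ 2 * v₁ * σ ^ 3) * B ^ 6 := by gcongr
      _ = 2 * Y := by rw [hYdef]; ring
  have hθle : geomRatio P σ ≤ Real.exp 1 * geomRatio P σ := le_mul_of_one_le_left hθ0 he1
  have hθY : geomRatio P σ ≤ 2 * Y := hθle.trans heθ
  -- `λ ≤ Y`
  have hM0 : 0 < P.M := P.M_pos
  have hov : ovDensity P σ ≤ Y := by
    rw [ovDensity]
    calc P.M * v₁ * σ ^ 3 ≤ B ^ 6 * v₁ * σ ^ 3 := by gcongr
      _ ≤ (Real.exp 1 ^ 2 * B ^ 6) * v₁ * σ ^ 3 := by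
          gcongr
          exact le_mul_of_one_le_left (by positivity) (one_le_pow₀ he1)
      _ = Y := by rw [hYdef]; ring
  refine ⟨hσ, h1, by linarith, by linarith, ?_, ?_⟩
  · rw [div_lt_iff₀ (by linarith)]
    linarith
  · have hsq : (399 / 400 : ℝ) ^ 2 ≤ (1 - geomRatio P σ) ^ 2 :=
      pow_le_pow_left₀ (by norm_num) (by linarith) 2
    have hpos : 0 < (1 - geomRatio P σ) ^ 2 := lt_of_lt_of_le (by norm_num) hsq
    rw [contractionC, mul_div_assoc', div_lt_one hpos]
    linarith

/-! ## The profile of an activity pinched in `[B⁻¹, B]` -/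

section Profile

variable {B : ℝ} {a : T3 → ℝ}

/-- Activities in `[B⁻¹, B]` are positive. [folklore] -/
theorem activity_pos (hB : 1 ≤ B) (hab : ∀ x, B⁻¹ ≤ a x ∧ a x ≤ B) (x : T3) : 0 < a x :=
  lt_of_lt_of_le (inv_pos.2 (lt_of_lt_of_le one_pos hB)) (hab x).1

/-- The integral of an activity in `[B⁻¹, B]` lies in `[B⁻¹, B]`. [folklore] -/
theorem integral_activity_mem (ha : Continuous a) (hab : ∀ x, B⁻¹ ≤ a x ∧ a x ≤ B) :
    B⁻¹ ≤ ∫ y, a y ∧ ∫ y, a y ≤ B := by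
  constructor
  · calc B⁻¹ = ∫ _ : T3, B⁻¹ := by simp
      _ ≤ ∫ y, a y :=
        integral_mono (integrable_const _) (integrable_of_continuous_T3 ha) fun y => (hab y).1
  · calc ∫ y, a y ≤ ∫ _ : T3, B :=
        integral_mono (integrable_of_continuous_T3 ha) (integrable_const _) fun y => (hab y).2
      _ = B := by simp

/-- `β = a / ∫ a ∈ [B⁻², B²]`. -/
theorem profile_β_mem (hB : 1 ≤ B) (ha : Continuous a) (hab : ∀ x, B⁻¹ ≤ a x ∧ a x ≤ B) (x : T3) :
    (B ^ 2)⁻¹ ≤ (profileOf a ha (activity_pos hB hab)).β x ∧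
      (profileOf a ha (activity_pos hB hab)).β x ≤ B ^ 2 := by
  rw [profileOf_β]
  obtain ⟨hZ1, hZ2⟩ := integral_activity_mem ha hab
  have hB0 : 0 < B := by linarith
  have hZ0 : 0 < ∫ y, a y := lt_of_lt_of_le (by positivity) hZ1
  constructor
  · rw [le_div_iff₀ hZ0]
    calc (B ^ 2)⁻¹ * ∫ y, a y ≤ (B ^ 2)⁻¹ * B := by gcongr
      _ = B⁻¹ := by field_simp
      _ ≤ a x := (hab x).1
  · rw [div_le_iff₀ hZ0]
    calc a x ≤ B := (hab x).2
      _ = B ^ 2 * B⁻¹ := by field_simp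
      _ ≤ B ^ 2 * ∫ y, a y := by gcongr

/-- `M = sup β ≤ B²`. -/
theorem profile_M_le (hB : 1 ≤ B) (ha : Continuous a) (hab : ∀ x, B⁻¹ ≤ a x ∧ a x ≤ B) :
    (profileOf a ha (activity_pos hB hab)).M ≤ B ^ 2 :=
  csSup_le (Set.range_nonempty _) (by
    rintro _ ⟨y, rfl⟩
    exact (profile_β_mem hB ha hab y).2)

end Profile

/-! ## The limit profile through the equation of state -/

/-- `γ₀ = 1`. -/
theorem clusterCoeff_zero_eq_one (P : DensityProfile) {σ : ℝ} (hσ : 0 < σ) :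
    clusterCoeff σ 0 = 1 := by
  have h1 := coefLim_one_zero (P := P) hσ
  rw [coefLim] at h1
  simpa [P.integral_eq_one] using h1

/-- `ρ_lim(x) = G (R β(x))` with `G = gSer (clusterCoeff σ)`. -/
theorem rhoLim_eq_gSer (P : DensityProfile) (σ : ℝ) (x : T3) :
    rhoLim P σ x = gSer (clusterCoeff σ) (ratioLimit P σ * P.β x) := by
  rw [rhoLim, gSer]
  refine tsum_congr fun j => ?_
  rw [mul_pow]; ring

-- (`integral_rhoLim_eq_one` of the HOME kit = tree `…Theorems.PolynomialCompressionStatics.integral_rhoLim_eq_one`; gate dedup at landing.)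

/-- **Statics package** for an activity `a ∈ [B⁻¹, B]` at `0 < σ < σ₀(B)`: with `β = a/∫a`,
`R = R(σ)` and `μ = log (R / ∫ a)` one has `exp μ · a = R β ∈ [0, 2B²]`, the reduced density is
small, `G (exp μ · a) = ρ_lim`, `∫ G (exp μ · a) = 1` and `G (exp μ · a) ≤ 4 B²`. -/
theorem statics_package {B σ : ℝ} (hB : 1 ≤ B) (hσ : 0 < σ) (hσ₀ : σ < sigma0 B)
    {a : T3 → ℝ} (ha : Continuous a) (hab : ∀ x, B⁻¹ ≤ a x ∧ a x ≤ B) :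
    ∃ μ : ℝ, (∫ x, gSer (clusterCoeff σ) (Real.exp μ * a x) = 1) ∧
      (∀ x, Real.exp μ * a x ∈ Icc (0:ℝ) (2 * B ^ 2)) ∧
      (∀ x, gSer (clusterCoeff σ) (Real.exp μ * a x) ≤ 4 * B ^ 2) ∧
      SmallDensity (profileOf a ha (activity_pos hB hab)) σ ∧
      (fun x => gSer (clusterCoeff σ) (Real.exp μ * a x)) =
        rhoLim (profileOf a ha (activity_pos hB hab)) σ := by
  obtain ⟨h1, hqr, -, h2Aqr2⟩ := constants_small hB hσ hσ₀
  set P := profileOf a ha (activity_pos hB hab) with hP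
  have hsm : SmallDensity P σ := smallDensity_of_M_le hB hσ hσ₀ P (profile_M_le hB ha hab)
  have hB0 : 0 < B := by linarith
  have hB2 : (1 : ℝ) ≤ B ^ 2 := one_le_pow₀ hB
  obtain ⟨hZ1, hZ2⟩ := integral_activity_mem ha hab
  have hZ0 : 0 < ∫ y, a y := lt_of_lt_of_le (by positivity) hZ1
  set R := ratioLimit P σ with hR
  have hR0 : 0 < R := hsm.ratioLimit_pos
  have hR2 : R ≤ 2 := hsm.ratioLimit_mem.2
  refine ⟨Real.log (R / ∫ y, a y), ?_⟩
  have hexp : ∀ x, Real.exp (Real.log (R / ∫ y, a y)) * a x = R * P.β x := by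
    intro x
    rw [Real.exp_log (div_pos hR0 hZ0), hP, profileOf_β]
    ring
  have hmem : ∀ x, R * P.β x ∈ Icc (0:ℝ) (2 * B ^ 2) := fun x =>
    ⟨(mul_pos hR0 (P.pos x)).le, mul_le_mul hR2 (profile_β_mem hB ha hab x).2 (P.pos x).le zero_le_two⟩
  have hfun : (fun x => gSer (clusterCoeff σ) (Real.exp (Real.log (R / ∫ y, a y)) * a x)) =
      rhoLim P σ := by
    funext x
    rw [hexp x, rhoLim_eq_gSer]
  -- the tail bound `|G z - z| ≤ 1` on `|z| ≤ 20 B²`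
  have hc0 : clusterCoeff σ 0 = 1 := clusterCoeff_zero_eq_one P hσ
  have hc := abs_clusterCoeff_le hσ h1
  have hq : 0 ≤ Real.exp 1 * (v₁ * σ ^ 3) := by have := v₁_pos; positivity
  have htail : ∀ z : ℝ, |z| ≤ 20 * B ^ 2 → |gSer (clusterCoeff σ) z - z| ≤ 1 := by
    intro z hz
    refine (abs_gSer_sub_le hc0 hc hq (by positivity) (by linarith) hz).trans h2Aqr2
  refine ⟨?_, fun x => (hexp x).symm ▸ hmem x, fun x => ?_, hsm, hfun⟩
  · rw [show (fun x => gSer (clusterCoeff σ) (Real.exp (Real.log (R / ∫ y, a y)) * a x)) =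
        rhoLim P σ from hfun]
    exact PolynomialCompressionStatics.integral_rhoLim_eq_one hsm
  · rw [hexp x]
    have hz : |R * P.β x| ≤ 20 * B ^ 2 := by
      rw [abs_of_nonneg (hmem x).1]
      linarith [(hmem x).2]
    have := (abs_le.1 (htail _ hz)).2
    linarith [(hmem x).2]

/-! ## The equation of state: smoothness, monotonicity, smooth inverse -/

/-- **`G`-package** at `0 < σ < σ₀(B)`: `G = gSer (clusterCoeff σ)` is `C^∞` on `(-1, 16B²)`,
strictly increasing on `[0, 8B²]`, with a `C^∞` inverse `Ginv` on `(-1, 8B²)`, `Ginv ∘ G = id`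
on `[0, 8B²]`, and `G ∘ Ginv = id`, `Ginv ∈ [0, 8B²]` on `[0, 4B²]`. -/
theorem eos_package {B σ : ℝ} (hB : 1 ≤ B) (hσ : 0 < σ) (hσ₀ : σ < sigma0 B) :
    ∃ Ginv : ℝ → ℝ,
      ContDiffOn ℝ ∞ (gSer (clusterCoeff σ)) (Ioo (-1) (16 * B ^ 2)) ∧
      ContDiffOn ℝ ∞ Ginv (Ioo (-1) (8 * B ^ 2)) ∧
      StrictMonoOn (gSer (clusterCoeff σ)) (Icc 0 (8 * B ^ 2)) ∧
      (∀ z ∈ Icc (0:ℝ) (8 * B ^ 2), Ginv (gSer (clusterCoeff σ) z) = z) ∧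
      (∀ y ∈ Icc (0:ℝ) (4 * B ^ 2), gSer (clusterCoeff σ) (Ginv y) = y ∧
        Ginv y ∈ Icc (0:ℝ) (8 * B ^ 2)) := by
  obtain ⟨h1, hqr, h8Aqr, h2Aqr2⟩ := constants_small hB hσ hσ₀
  have hB0 : 0 < B := by linarith
  have hB2 : (1 : ℝ) ≤ B ^ 2 := one_le_pow₀ hB
  set G := gSer (clusterCoeff σ) with hG
  -- any profile gives `γ₀ = 1`
  have hc0 : clusterCoeff σ 0 = 1 := clusterCoeff_zero_eq_one uniformProfile hσ
  have hc := abs_clusterCoeff_le hσ h1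
  have hq : 0 ≤ Real.exp 1 * (v₁ * σ ^ 3) := by have := v₁_pos; positivity
  have hr : (0 : ℝ) < 20 * B ^ 2 := by positivity
  have htail : ∀ z : ℝ, |z| ≤ 20 * B ^ 2 → |G z - z| ≤ 1 := fun z hz =>
    (abs_gSer_sub_le hc0 hc hq hr.le (by linarith) hz).trans h2Aqr2
  have hcd : ContDiffOn ℝ ∞ G (Ioo (-(20 * B ^ 2)) (20 * B ^ 2)) := contDiffOn_gSer hc hq hr hqr
  have hmono : StrictMonoOn G (Ioo (-(20 * B ^ 2)) (20 * B ^ 2)) :=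
    strictMonoOn_gSer hc0 hc hq hr hqr h8Aqr
  have hcont : ContinuousOn G (Icc 0 (8 * B ^ 2)) :=
    (continuousOn_gSer hc hq hr hqr).mono fun z hz => ⟨by linarith [hz.1], by linarith [hz.2]⟩
  obtain ⟨Ginv, hGinv, hleft⟩ := exists_smooth_inverse hc0 hc hq hr hqr h8Aqr
    (a := -2) (b := 17 * B ^ 2) (by linarith) (by linarith) (by linarith)
  -- values of `G` at the ends
  have hGm2 : G (-2) ≤ -1 := by
    have := (abs_le.1 (htail (-2) (by rw [abs_neg, abs_two]; linarith))).2; linarith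
  have hG17 : 8 * B ^ 2 ≤ G (17 * B ^ 2) := by
    have := (abs_le.1 (htail (17 * B ^ 2) (by rw [abs_of_nonneg (by positivity)]; linarith))).1
    linarith
  have hG8 : 4 * B ^ 2 ≤ G (8 * B ^ 2) := by
    have := (abs_le.1 (htail (8 * B ^ 2) (by rw [abs_of_nonneg (by positivity)]; linarith))).1
    linarith
  have hG0 : G 0 = 0 := gSer_zero _
  refine ⟨Ginv, hcd.mono ?_, hGinv.mono ?_, hmono.mono ?_, fun z hz => hleft z ⟨by linarith [hz.1],
    by linarith [hz.2]⟩, fun y hy => ?_⟩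
  · exact Ioo_subset_Ioo (by linarith) (by linarith)
  · exact fun w hw => ⟨hGm2.trans hw.1.le, hw.2.le.trans hG17⟩
  · exact fun z hz => ⟨by linarith [hz.1], by linarith [hz.2]⟩
  · have hy' : y ∈ Icc (G 0) (G (8 * B ^ 2)) := ⟨hG0.symm ▸ hy.1, hy.2.trans hG8⟩
    obtain ⟨z, hz, hzy⟩ := intermediate_value_Icc (by positivity) hcont hy'
    have hGinvy : Ginv y = z := by rw [← hzy]; exact hleft z ⟨by linarith [hz.1], by linarith [hz.2]⟩
    rw [hGinvy]
    exact ⟨hzy, hz⟩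

end Summit.AtomisticToContinuum.HydrodynamicLimit.Theorems.PreShockDoor
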